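import Summits.HodgeConjecture.CorCM.Census.DihedralSurfaceTripleDegrees
import HarnessLib

/-!
# The coniveau-one part of `H³` of the pair `S₂ × S₁′` — a kernel census (general Hodge conjecture shadow of the D₄ triple)

COR-CM (cell `pub-hodgecm2`), literature seat André-3, gen 3 (portfolio pass, 2026-08-21; deliverable
`run/shared/lean/pub/pub-hodgecm2/pub-hodgecm2-lit-andre-3/PORTFOLIO-lit-andre-3-g3.md` §3).  A finite, kernel-decided
computation in the four-factor model of `Census/DihedralSurfaceTripleDegrees.lean` (`FourCore`: points `(b, i)`, factors
`0 = S₁`, `1 = S₂`, `2 = S₁′`, `3 = S₂′`, type `phi4`, `D₄` acting through `act4`); no named fact, no geometry, no `sorry`.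

CONTEXT.  `Census/DihedralSurfaceTriple.lean` (p239932) found the four exceptional codimension-`2` Hodge classes `E` of
`Y = S₁ × S₂ × S₁′`; `Census/DihedralSurfaceTripleDegrees.lean` (p243525) showed «HC(Y) in every degree ⟺ `E` algebraic ⟺ one
non-zero algebraic class in `E`».  Dropping the `S₁`-embedding from an exceptional `4`-set leaves a `3`-set of embeddings of the
PAIR `Z := S₂ × S₁′` — a stably nondegenerate CM abelian fourfold (its Hodge group is the full `4`-dimensional torus
`Hg(S₂) × Hg(S₁′)`, so every Hodge class on every power of `Z` is a polynomial in divisor classes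
[cite: Gordon1999HodgeAVSurvey, Thm 7.5]).  This file isolates what the GENERAL Hodge conjecture
[cite: Voisin2025, Conjecture 4.6] asks of `Z` in degree `3`.

DICTIONARY (cited, not formalised).  (i) For a CM abelian variety `A` with type `Φ` on `Hom(E, ℚ̄)`, `Hᵏ(A, ℚ) ⊗ ℚ̄` has the
eigenbasis `e_P`, `P ⊂ Hom(E, ℚ̄)`, `|P| = k`, for the action of `E`, and `e_P` has Hodge type `(|P ∩ Φ|, |P ∩ Φ̄|)`
[cite: Pohlmann1968, §1] [cite: GaoUllmo2025, §2.1 and Thm 3.1].  (ii) For `Z = S₂ × S₁′` and a `3`-set `P` containing no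
complex-conjugate pair, the characters of the Lefschetz torus on the `e_{gP}`, `g ∈ D₄`, are pairwise distinct and distinct from
those of all other `3`-sets, so the `ℚ̄`-span of the Galois orbit `{e_{gP}}` is `V_P ⊗ ℚ̄` for a rational Hodge substructure
`V_P ⊂ H³(Z, ℚ)` of dimension `|D₄ · P|`, whose Hodge numbers are read off from the types of the orbit [folklore; (i) plus
Galois descent].  (iii) `V_P` has Hodge coniveau `≥ 1` [cite: Voisin2025, Definition 2.4] iff no `gP` has type `(3,0)` or
`(0,3)`; the general Hodge conjecture [cite: Voisin2025, Conjecture 4.6] then asks that `V_P` be supported on a divisor of `Z`.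
(iv) A `3`-set containing a conjugate pair `{x, cx}` indexes a class in `NS(Z) · H¹(Z)`, supported on that divisor
[cite: Voisin2025, Example 4.2].

RESULTS (kernel).  Among the `56` eigenlines of `H³(S₂ × S₁′)`: `8` are of type `(3,0)/(0,3)`; `24` lie in `NS · H¹`; of the
remaining `24`, exactly `8` generate Hodge substructures of coniveau `≥ 1`, and they form TWO `D₄`-orbits of size `4`:
`V = ⟨e_{(1,i)} ∧ e_{(1,i+1)} ⊗ e_{(2,i)}⟩` (Künneth bidegree `(2,1)`) and `W = ⟨e_{(1,i)} ⊗ e_{(2,i)} ∧ e_{(2,i-1)}⟩`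
(bidegree `(1,2)`); the other `16` generate Hodge structures containing a `(3,0)`-line.  Moreover the UNIQUE embedding `x` of
`S₁ ⊔ S₂′` completing a member of `V` (resp. `W`) to a Pohlmann `4`-set of the four-core is `x = (0, i)` (resp. `(3, i)`):
`V ⊗ H¹(S₁) ⊃ E` recovers the exceptional classes of the triple `(S₁, S₂, S₁′)` of p239932 and `W ⊗ H¹(S₂′)` those of the
triple `(S₂, S₁′, S₂′)`, and neither pairs with the other surface.  READING (portfolio note §3, not a Lean statement): the
general Hodge conjecture for the stably nondegenerate pair `S₂ × S₁′` in degree `3` is EQUIVALENT to the Hodge conjecture for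
the two exceptional `4`-spaces of the triples `S₁ × S₂ × S₁′` and `S₂ × S₁′ × S₂′` (Grothendieck's argument
[cite: Abdulali2016TateTwists, Prop. 3.2] in one direction, Deligne's support theorem [cite: Voisin2025, Theorem 4.4 and
Corollary 4.5] plus Lieberman's Lefschetz operator on `S₁` in the other); it is not on the list of known cases
[cite: Abdulali2016TateTwists, Appendix A] (the CM fields `K₁`, `K₂` of the two factors have the same Galois closure, so
[cite: Abdulali2016TateTwists, Thm 5.3] does not apply).

## Provenance
Kernel cost: `decide +kernel` over the `56` three-subsets of eight points and eight group elements (seconds).  Companion script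
(exact python, same conventions): seat folder `scratch/pair_coniveau.py`, copy in
`run/shared/lean/pub/pub-hodgecm2/pub-hodgecm2-lit-andre-3/g3/`.
-/

namespace Summit.HodgeConjecture.CorCM.Census.DihedralPairConiveau

open Finset
open Summit.HodgeConjecture.CorCM.Census.DihedralSurfaceTriple.FourCore

/-- The eight embeddings of the pair `Z = S₂ × S₁′` (factors `1` and `2` of the four-core). [folklore] -/
def pairPts : Finset Pt4 := pts4.filter fun x => x.1 = 1 ∨ x.1 = 2

/-- The `56` three-subsets of `Hom(K₂, ℚ̄) ⊔ Hom(K₁, ℚ̄)`: the eigenbasis of `H³(S₂ × S₁′, ℚ) ⊗ ℚ̄`.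
[cite: GaoUllmo2025, §2.1] -/
def triples : Finset (Finset Pt4) := pairPts.powersetCard 3

/-- The `p` of the Hodge type `(p, 3 - p)` of the eigenline `e_P`: the number of elements of `P` in the type `phi4`.
[cite: Pohlmann1968, §1] -/
def hodgeP (P : Finset Pt4) : ℕ := (P.filter fun x => x ∈ phi4).card

/-- `P` contains no complex-conjugate pair `{x, c x}` (`c = r²` acts as `act4 2 false`). [folklore] -/
def pairFree (P : Finset Pt4) : Bool := decide (∀ x ∈ P, act4 2 false x ∉ P)

/-- Every eigenline in the `D₄`-orbit of `e_P` has type `(2,1)` or `(1,2)`: the rational Hodge structure generated by `e_P`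
has Hodge coniveau `≥ 1`. [cite: Voisin2025, Definition 2.4] -/
def orbitConiveauOne (P : Finset Pt4) : Bool :=
  decide (∀ g : ZMod 4 × Bool, hodgeP (P.image (act4 g.1 g.2)) = 1 ∨ hodgeP (P.image (act4 g.1 g.2)) = 2)

/-- The exceptional coniveau-one eigenlines of `H³(S₂ × S₁′)`: pair-free (not in `NS · H¹`) and generating a Hodge structure
of coniveau `≥ 1` — the part of `H³` about which the general Hodge conjecture [cite: Voisin2025, Conjecture 4.6] says
something not already given by divisors. -/
def excConiveau : Finset (Finset Pt4) := triples.filter fun P => pairFree P = true ∧ orbitConiveauOne P = true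

/-- The family `V`: `e_{(1,i)} ∧ e_{(1,i+1)} ⊗ e_{(2,i)}`, two embeddings of `S₂` and one of `S₁′`. [folklore] -/
def famV (i : ZMod 4) : Finset Pt4 := {((1 : Fin 4), i), (1, i + 1), (2, i)}

/-- The family `W`: `e_{(1,i)} ⊗ e_{(2,i)} ∧ e_{(2,i+3)}`, one embedding of `S₂` and two of `S₁′`. [folklore] -/
def famW (i : ZMod 4) : Finset Pt4 := {((1 : Fin 4), i), (2, i), (2, i + 3)}

set_option maxRecDepth 8000 in
set_option maxHeartbeats 4000000 in
/-- **Bookkeeping**: `56` eigenlines; `8` of type `(3,0)` or `(0,3)` (`h^{3,0}(Z) = 4`); `24` contain a conjugate pair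
`{x, c x}` (by definition of `pairFree`), i.e. are `(conjugate pair) ⊔ (point)` and index classes in `NS(Z) · H¹(Z)`.
[cite: GaoUllmo2025, Thm 3.1] -/
theorem card_triples :
    triples.card = 56 ∧ (triples.filter fun P => hodgeP P = 0 ∨ hodgeP P = 3).card = 8 ∧
    (triples.filter fun P => pairFree P = false).card = 24 := by
  decide +kernel

set_option maxRecDepth 8000 in
set_option maxHeartbeats 4000000 in
/-- **The census**: the exceptional coniveau-one eigenlines are exactly the eight lines of the two families `V`, `W`;
the remaining `16` pair-free eigenlines of mixed type each have a `D₄`-translate of type `(3,0)` or `(0,3)`. -/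
theorem excConiveau_eq :
    excConiveau = univ.image famV ∪ univ.image famW ∧ excConiveau.card = 8 ∧
    (triples.filter fun P => pairFree P = true ∧ (hodgeP P = 1 ∨ hodgeP P = 2) ∧ orbitConiveauOne P = false).card
      = 16 := by
  decide +kernel

set_option maxRecDepth 8000 in
set_option maxHeartbeats 4000000 in
/-- **Two Hodge substructures of dimension four**: each family is a single `D₄`-orbit (so `V := V_{famV 0}` and
`W := V_{famW 0}` are `4`-dimensional rational Hodge substructures of `H³(S₂ × S₁′, ℚ)`), of Hodge types
`(2,1) + (1,2)` with `h^{2,1} = h^{1,2} = 2`. [cite: GaoUllmo2025, Thm 3.1] -/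
theorem famV_famW_orbits :
    (∀ i : ZMod 4, ∀ g : ZMod 4 × Bool, ∃ j : ZMod 4, (famV i).image (act4 g.1 g.2) = famV j) ∧
    (∀ i j : ZMod 4, ∃ g : ZMod 4 × Bool, (famV i).image (act4 g.1 g.2) = famV j) ∧
    (∀ i : ZMod 4, ∀ g : ZMod 4 × Bool, ∃ j : ZMod 4, (famW i).image (act4 g.1 g.2) = famW j) ∧
    (∀ i j : ZMod 4, ∃ g : ZMod 4 × Bool, (famW i).image (act4 g.1 g.2) = famW j) ∧
    (univ.filter fun i : ZMod 4 => hodgeP (famV i) = 2).card = 2 ∧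
    (univ.filter fun i : ZMod 4 => hodgeP (famV i) = 1).card = 2 ∧
    (univ.filter fun i : ZMod 4 => hodgeP (famW i) = 2).card = 2 ∧
    (univ.filter fun i : ZMod 4 => hodgeP (famW i) = 1).card = 2 := by
  decide +kernel

set_option maxRecDepth 8000 in
set_option maxHeartbeats 4000000 in
/-- **Completion to Hodge classes of the triples**: the only embedding of `S₁ ⊔ S₂′` that completes `famV i` to a
Pohlmann `4`-set of the four-core is `(0, i)` — giving the exceptional class `{(0,i),(1,i),(1,i+1),(2,i)}` of
`S₁ × S₂ × S₁′` (p239932 `exceptional_eq`) — and the only one completing `famW i` is `(3, i)` — giving the exceptional class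
`{(1,i),(2,i),(2,i+3),(3,i)}` of `S₂ × S₁′ × S₂′` (p243525 `FourCore.excFour`, fourth family).  So `V ⊗ H¹(S₁)` and
`W ⊗ H¹(S₂′)` carry the Hodge classes, while `V ⊗ H¹(S₂′)` and `W ⊗ H¹(S₁)` carry none. [cite: GaoUllmo2025, Thm 3.1] -/
theorem famV_famW_completion :
    (∀ i : ZMod 4, (pts4.filter fun x => (x.1 = 0 ∨ x.1 = 3) ∧ isHodge4 2 (insert x (famV i)) = true)
        = {((0 : Fin 4), i)}) ∧
    (∀ i : ZMod 4, (pts4.filter fun x => (x.1 = 0 ∨ x.1 = 3) ∧ isHodge4 2 (insert x (famW i)) = true)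
        = {((3 : Fin 4), i)}) ∧
    (∀ i : ZMod 4, isHodge4 2 (insert ((0 : Fin 4), i) (famV i)) = true ∧
      isHodge4 2 (insert ((3 : Fin 4), i) (famW i)) = true) := by
  decide +kernel

end Summit.HodgeConjecture.CorCM.Census.DihedralPairConiveau
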